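import Literature.MathematicalPhysics.QuantumManyBody.BogoliubovSpectrumGP
import Literature.MathematicalPhysics.QuantumManyBody.BogoliubovSpectralGapGP
import Literature.Barriers.AtomisticToContinuum.KineticGapLengthScalesScaling
import HarnessLib

/-!
# The Bogoliubov excitation spectrum in the Gross–Pitaevskii regime: the "trivial rescaling"

Companion (proofs file) of `BogoliubovSpectrumGP.lean` (named fact
`BoccatoEtAl2019Acta_firstExcitation`, provefact unit
`Literature.MathematicalPhysics.QuantumManyBody.BoseGas.BoccatoEtAl2019Acta_firstExcitation`).

Source: C. Boccato, C. Brennecke, S. Cenatiempo, B. Schlein, *Bogoliubov theory in the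
Gross–Pitaevskii limit*, Acta Math. **222** (2019) 219–335 = arXiv:1801.01389
[BoccatoEtAl2019Acta]. Page 4 of the arXiv version (after Theorem 1.1 and (1.7)) prints:
*"Multiplying lengths by `N`, it is easy to check that the Gross–Pitaevskii regime considered in
this paper is equivalent (up to a trivial rescaling) to an extended gas of `N` particles moving in
a box with volume `Vol = N³` and interacting through a fixed potential `V` with scattering length
`𝔞₀` of order one, independent of `N`"* (and, p. 4 again, "the energy has to be multiplied by an
additional factor `N²` to make up for rescaling lengths").

This file PROVES that rescaling for the objects of `PeriodicBoseGas.lean` /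
`BogoliubovSpectrumGP.lean` and uses it to identify the two renderings of BBCS Theorem 1.1
(first excited level, Ky-Fan form) that the tree carries:

* `BoccatoEtAl2019Acta_firstExcitation` (`BogoliubovSpectrumGP.lean`): unit torus, interaction
  `N²V(N·)` (`gpScaledPotential V N`), the paper's own variables;
* `BoccatoEtAl2019_firstGap_GP` (`BogoliubovSpectralGapGP.lean`): box of side `L = Nℓ`, unscaled
  `v`, scattering length `a/ℓ` — the rescaled variables of p. 4 (with a free unit of length `ℓ`).

Main results:

* `gpScaledPotential_eq_scaledPotential` — `N²V(N r) = scaledPotential V N⁻¹ r` (the GP scaling is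
  LSSY's (5.3) `a⁻²v₁(r/a)` with `a = 1/N`);
* `setIntegral_conj_mul_dilate` — the dilation `Ψ ↦ b^{-3N/2}Ψ(·/b)` of
  `KineticGapLengthScalesScaling.lean` preserves `L²` inner products on the fundamental cell, hence
  orthogonality;
* `kyFanTwo_scaledPotential` — `K₂(b⁻²v(·/b), N, bM) = b⁻² K₂(v, N, M)` for the Ky-Fan two-sum
  `kyFanTwo` (infimum of `⟨Ψ₁,HΨ₁⟩ + ⟨Ψ₂,HΨ₂⟩` over orthonormal pairs), the two-state analogue of
  `periodicGroundStateEnergy_scaledPotential`;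
* `periodicGroundStateEnergy_gpScaledPotential`, `kyFanTwo_gpScaledPotential` — BBCS p. 4:
  `E(N²V(N·), N, 1) = N² E(V, N, N)` and `K₂(N²V(N·), N, 1) = N² K₂(V, N, N)`;
* `scatteringLength_scaledPotential` — LSSY (5.3) / BBCS p. 3: `a⁻²v(·/a)` has scattering
  length `a · 𝔞(v)` (so `N²V(N·)` has scattering length `𝔞₀/N`), by dilating the trial functions
  of the Lieb–Yngvason variational principle `scatteringLength`;
* `BoccatoEtAl2019Acta_firstExcitation_of_firstGap_GP` —
  `BoccatoEtAl2019_firstGap_GP → BoccatoEtAl2019Acta_firstExcitation` (take `ℓ = 1` and multiply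
  the two printed inequalities by `N²`);
* `BoccatoEtAl2019_firstGap_GP_of_firstExcitation` and
  `BoccatoEtAl2019Acta_firstExcitation_iff_firstGap_GP` — conversely, the box-variable fact for
  `(v, ℓ)` is the unit-torus fact for the profile `V = ℓ²v(ℓ·)` (`scaledPotential v ℓ⁻¹`, whose
  scattering length is `a/ℓ`), divided by `L² = (Nℓ)²`.

So the two renderings are EQUIVALENT theorems of the tree: its two BBCS debts are one, and
discharging either fact discharges both. What is NOT here: a proof of either fact — that is the whole of
BBCS (117 pp.: second quantisation on the bosonic Fock space over `L²(Λ)`, generalised Bogoliubov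
and cubic renormalisations `e^{B(η)}`, `e^{A}`, the optimal-rate condensation input of
Boccato–Brennecke–Cenatiempo–Schlein CMP 2018 / 2020, diagonalisation and min–max for unbounded
operators), none of which Mathlib or `Literature/` has yet.

Design: the dilation API (`PeriodicTrialState.dilate`, `periodicEnergy_dilate`,
`periodicGroundStateEnergy_scaledPotential`, `scaledPotential`) is imported from
`Literature/Barriers/AtomisticToContinuum/KineticGapLengthScales(Scaling).lean` rather than
restated; this proofs file is a sibling of the fact file precisely so that the fact file's import
cone is unchanged.
-/

noncomputable section

open MeasureTheory
open scoped ENNReal NNReal ComplexConjugate Pointwise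
open Literature.Barriers.AtomisticToContinuum.BoseGas

namespace Literature.MathematicalPhysics.QuantumManyBody.BoseGas

variable {N : ℕ}

/-! ### The GP scaling is an LSSY scaling -/

/-- `N² V(N r) = (N⁻¹)⁻² V(r / N⁻¹)`: the Gross–Pitaevskii scaled profile `gpScaledPotential V N`
is LSSY's scaled interaction `scaledPotential V a` [(5.3)] at `a = 1/N` (`N ≥ 1`).
[cite: BoccatoEtAl2019Acta, Thm 1.1 (1.1) and p. 4] -/
theorem gpScaledPotential_eq_scaledPotential (V : ℝ → ℝ≥0∞) {N : ℕ} (hN : 0 < N) :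
    gpScaledPotential V N = scaledPotential V ((N : ℝ)⁻¹) := by
  funext r
  have hN' : (0 : ℝ) < N := Nat.cast_pos.2 hN
  simp only [gpScaledPotential, scaledPotential]
  rw [inv_pow, ENNReal.ofReal_inv_of_pos (by positivity), inv_inv, ENNReal.ofReal_pow hN'.le,
    ENNReal.ofReal_natCast, div_inv_eq_mul, mul_comm r]

/-! ### Dilation preserves inner products on the cell -/

/-- `b⁻¹ • [0, bM)^{3N} = [0, M)^{3N}` (`b > 0`). [folklore] -/
theorem inv_smul_cellN {b : ℝ} (hb : 0 < b) (M : ℝ) :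
    b⁻¹ • cellN N (b * M) = cellN N M := by
  ext X
  rw [Set.mem_smul_set_iff_inv_smul_mem₀ (inv_ne_zero hb.ne'), inv_inv,
    mem_cellN_iff_inv_smul_mem hb M, inv_smul_smul₀ hb.ne']

/-- **Dilation is unitary on the cell**: for `Ψᵢ = b^{-3N/2} Φᵢ(·/b)`,
`∫_{[0,bM)^{3N}} conj(Ψ₁) Ψ₂ = ∫_{[0,M)^{3N}} conj(Φ₁) Φ₂` (change of variables `X = bY`,
`dX = b^{3N} dY`). In particular dilation preserves orthogonality. [folklore] -/
theorem setIntegral_conj_mul_dilate {M M' b : ℝ} (hb : 0 < b) (hM : M' = b * M)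
    (Φ₁ Φ₂ : PeriodicTrialState N M) :
    ∫ X in cellN N M', conj ((Φ₁.dilate b hb hM).ψ X) * (Φ₂.dilate b hb hM).ψ X =
      ∫ X in cellN N M, conj (Φ₁.ψ X) * Φ₂.ψ X := by
  subst hM
  have hc : ∀ X : Config N, conj ((Φ₁.dilate b hb rfl).ψ X) * (Φ₂.dilate b hb rfl).ψ X =
      ((dilateConst b N ^ 2 : ℝ) : ℂ) * (fun Y => conj (Φ₁.ψ Y) * Φ₂.ψ Y) (b⁻¹ • X) := by
    intro X
    simp only [PeriodicTrialState.dilate_ψ, map_mul, Complex.conj_ofReal, Complex.ofReal_pow]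
    ring
  simp_rw [hc]
  rw [integral_const_mul, Measure.setIntegral_comp_smul_of_pos volume
      (fun Y => conj (Φ₁.ψ Y) * Φ₂.ψ Y) (cellN N (b * M)) (inv_pos.2 hb),
    inv_smul_cellN hb M, finrank_config, inv_pow, inv_inv, Complex.real_smul, ← mul_assoc,
    ← Complex.ofReal_mul, pow_mul, dilateConst_sq_mul hb N, Complex.ofReal_one, one_mul]

/-! ### The Ky-Fan two-sum under scaling -/

/-- The Ky-Fan two-sum dominates twice the ground-state energy: every term of the infimum is
`⟨Ψ₁,HΨ₁⟩ + ⟨Ψ₂,HΨ₂⟩ ≥ E₀ + E₀`. [folklore] -/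
theorem two_mul_periodicGroundStateEnergy_le_kyFanTwo (v : ℝ → ℝ≥0∞) (N : ℕ) (L : ℝ) :
    2 * periodicGroundStateEnergy v N L ≤ kyFanTwo v N L := by
  unfold kyFanTwo
  refine le_iInf fun Φ₁ => le_iInf fun Φ₂ => le_iInf fun _ => ?_
  rw [two_mul]
  exact add_le_add (periodicGroundStateEnergy_le v Φ₁) (periodicGroundStateEnergy_le v Φ₂)

/-- One half of the covariance of the Ky-Fan two-sum: `K₂(b⁻²v(·/b), N, bM) ≤ b⁻² K₂(v, N, M)`
(dilate both states of an orthogonal pair; dilation preserves orthogonality and multiplies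
energies by `b⁻²`). [cite: BoccatoEtAl2019Acta, p. 4 (trivial rescaling)] -/
theorem kyFanTwo_scaledPotential_le {M M' b : ℝ} (hb : 0 < b) (hM : M' = b * M)
    (w : ℝ → ℝ≥0∞) (N : ℕ) :
    kyFanTwo (scaledPotential w b) N M' ≤ (ENNReal.ofReal (b ^ 2))⁻¹ * kyFanTwo w N M := by
  have ht : (ENNReal.ofReal (b ^ 2))⁻¹ ≠ ⊤ := ENNReal.inv_ne_top.2 (by simpa using hb.ne')
  unfold kyFanTwo
  rw [ENNReal.mul_iInf_of_ne (by simp) ht]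
  refine le_iInf fun Φ₁ => ?_
  rw [ENNReal.mul_iInf_of_ne (by simp) ht]
  refine le_iInf fun Φ₂ => ?_
  rw [ENNReal.mul_iInf_of_ne (by simp) ht]
  refine le_iInf fun horth => ?_
  have horth' : ∫ X in cellN N M', conj ((Φ₁.dilate b hb hM).ψ X) * (Φ₂.dilate b hb hM).ψ X = 0 := by
    rw [setIntegral_conj_mul_dilate hb hM, horth]
  calc ⨅ (Ψ₁ : PeriodicTrialState N M') (Ψ₂ : PeriodicTrialState N M')
        (_ : ∫ X in cellN N M', conj (Ψ₁.ψ X) * Ψ₂.ψ X = 0),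
        periodicEnergy (scaledPotential w b) Ψ₁ + periodicEnergy (scaledPotential w b) Ψ₂
      ≤ periodicEnergy (scaledPotential w b) (Φ₁.dilate b hb hM) +
          periodicEnergy (scaledPotential w b) (Φ₂.dilate b hb hM) :=
        iInf_le_of_le (Φ₁.dilate b hb hM) (iInf_le_of_le (Φ₂.dilate b hb hM) (iInf_le _ horth'))
    _ = (ENNReal.ofReal (b ^ 2))⁻¹ * (periodicEnergy w Φ₁ + periodicEnergy w Φ₂) := by
        rw [periodicEnergy_dilate hb hM, periodicEnergy_dilate hb hM, mul_add]

/-- **Covariance of the Ky-Fan two-sum**: `K₂(b⁻²v(·/b), N, M') = b⁻² K₂(v, N, M)` for `M' = bM`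
(dilate by `b`, and back by `b⁻¹`). [cite: BoccatoEtAl2019Acta, p. 4 (trivial rescaling)] -/
theorem kyFanTwo_scaledPotential {M M' b : ℝ} (hb : 0 < b) (hM : M' = b * M)
    (w : ℝ → ℝ≥0∞) (N : ℕ) :
    kyFanTwo (scaledPotential w b) N M' = (ENNReal.ofReal (b ^ 2))⁻¹ * kyFanTwo w N M := by
  refine le_antisymm (kyFanTwo_scaledPotential_le hb hM w N) ?_
  have h := kyFanTwo_scaledPotential_le (inv_pos.2 hb)
    (show M = b⁻¹ * M' by rw [hM, inv_mul_cancel_left₀ hb.ne']) (scaledPotential w b) N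
  rw [scaledPotential_scaledPotential_inv hb] at h
  have h2 : (ENNReal.ofReal (b ^ 2))⁻¹ * (ENNReal.ofReal (b⁻¹ ^ 2))⁻¹ = 1 := by
    rw [← ENNReal.mul_inv (Or.inl (by simpa using hb.ne')) (Or.inl ENNReal.ofReal_ne_top),
      ← ENNReal.ofReal_mul (sq_nonneg _), inv_pow, mul_inv_cancel₀ (pow_ne_zero _ hb.ne'),
      ENNReal.ofReal_one, inv_one]
  calc (ENNReal.ofReal (b ^ 2))⁻¹ * kyFanTwo w N M
      ≤ (ENNReal.ofReal (b ^ 2))⁻¹ *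
          ((ENNReal.ofReal (b⁻¹ ^ 2))⁻¹ * kyFanTwo (scaledPotential w b) N M') :=
        mul_le_mul_right h _
    _ = kyFanTwo (scaledPotential w b) N M' := by rw [← mul_assoc, h2, one_mul]

/-- Covariance of the ground-state energy with a flexible side: `E₀(b⁻²v(·/b), N, M') =
b⁻² E₀(v, N, M)` for `M' = bM` (`periodicGroundStateEnergy_scaledPotential` of the scaling file,
restated with the side as a hypothesis). [cite: LSSY2005, Ch. 5, footnote to (5.3)] -/
theorem periodicGroundStateEnergy_scaledPotential_of_eq {M M' b : ℝ} (hb : 0 < b)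
    (hM : M' = b * M) (w : ℝ → ℝ≥0∞) (N : ℕ) :
    periodicGroundStateEnergy (scaledPotential w b) N M' =
      (ENNReal.ofReal (b ^ 2))⁻¹ * periodicGroundStateEnergy w N M := by
  subst hM
  exact periodicGroundStateEnergy_scaledPotential hb w N

/-! ### BBCS p. 4: the unit torus with `N²V(N·)` is the box of side `N` with `V` -/

/-- **"Multiplying lengths by `N`"** (BBCS p. 4), ground-state energy: the periodic ground-state
energy of `H_N = ∑ -Δⱼ + ∑ N²V(N(xᵢ-xⱼ))` on the unit torus is `N²` times that of `N` bosons with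
the UNSCALED pair potential `V` in the periodic box of side `N` (stated for any real `M = N`, e.g.
`M = N·1`). [cite: BoccatoEtAl2019Acta, p. 4 (trivial rescaling)] -/
theorem periodicGroundStateEnergy_gpScaledPotential (V : ℝ → ℝ≥0∞) {N : ℕ} (hN : 0 < N)
    {M : ℝ} (hM : M = N) :
    periodicGroundStateEnergy (gpScaledPotential V N) N 1 =
      ENNReal.ofReal ((N : ℝ) ^ 2) * periodicGroundStateEnergy V N M := by
  have hN' : (0 : ℝ) < N := Nat.cast_pos.2 hN
  have h1 : (1 : ℝ) = (N : ℝ)⁻¹ * M := by rw [hM, inv_mul_cancel₀ hN'.ne']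
  rw [gpScaledPotential_eq_scaledPotential V hN,
    periodicGroundStateEnergy_scaledPotential_of_eq (inv_pos.2 hN') h1, inv_pow,
    ENNReal.ofReal_inv_of_pos (by positivity), inv_inv]

/-- **"Multiplying lengths by `N`"** (BBCS p. 4), Ky-Fan two-sum (sum of the two lowest
levels): `K₂(N²V(N·), N, 1) = N² K₂(V, N, N)`. [cite: BoccatoEtAl2019Acta, p. 4 (trivial rescaling)] -/
theorem kyFanTwo_gpScaledPotential (V : ℝ → ℝ≥0∞) {N : ℕ} (hN : 0 < N) {M : ℝ} (hM : M = N) :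
    kyFanTwo (gpScaledPotential V N) N 1 = ENNReal.ofReal ((N : ℝ) ^ 2) * kyFanTwo V N M := by
  have hN' : (0 : ℝ) < N := Nat.cast_pos.2 hN
  have h1 : (1 : ℝ) = (N : ℝ)⁻¹ * M := by rw [hM, inv_mul_cancel₀ hN'.ne']
  rw [gpScaledPotential_eq_scaledPotential V hN, kyFanTwo_scaledPotential (inv_pos.2 hN') h1,
    inv_pow, ENNReal.ofReal_inv_of_pos (by positivity), inv_inv]

/-! ### The unit-torus fact from the box-variable fact -/

/-- **BBCS Theorem 1.1 (first excited level): the unit-torus rendering follows from the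
box-variable rendering.** Take `ℓ = 1` in `BoccatoEtAl2019_firstGap_GP` (box of side `L = N`,
unscaled `V`, `𝔞₀ = a/1 = a`), multiply its two inequalities
`S₂ ≤ 2E₀ + (ε + CN^{-1/4})/N²`, `2E₀ + ε/N² ≤ S₂ + CN^{-1/4}/N²` by `N²` and use
`E(N²V(N·), N, 1) = N²E₀`, `K₂(N²V(N·), N, 1) = N²S₂` (`periodicGroundStateEnergy_gpScaledPotential`,
`kyFanTwo_gpScaledPotential`); the lower inequality is rewritten without the error on the right
(`2E + (ε - C'N^{-1/4})₊ ≤ K₂`, using `K₂ ≥ 2E` when the bracket is negative), with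
`C' = max C 0`. [cite: BoccatoEtAl2019Acta, Thm 1.1 with §6 (6.2) (m = 2) and p. 4 (trivial rescaling)] -/
theorem BoccatoEtAl2019Acta_firstExcitation_of_firstGap_GP (h : BoccatoEtAl2019_firstGap_GP) :
    BoccatoEtAl2019Acta_firstExcitation := by
  intro V hV hL3 hsupp
  obtain ⟨R₀, hR₀⟩ := hsupp
  obtain ⟨C, N₀, hN⟩ := h V R₀ 1 hV (fun r hr => hR₀ r hr.le) hL3 one_pos
  refine ⟨max C 0, max N₀ 1, fun N hNle => ?_⟩
  have hN₀ : N₀ ≤ N := le_of_max_le_left hNle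
  have hN1 : 1 ≤ N := le_of_max_le_right hNle
  have hNpos : (0 : ℝ) < N := by exact_mod_cast hN1
  have hN2 : (0 : ℝ) ≤ (N : ℝ) ^ 2 := sq_nonneg _
  dsimp only
  set a : ℝ := (scatteringLength V).toReal with ha_def
  set c₀ : ℝ := (N : ℝ) ^ (-(1 / 4 : ℝ)) with hc₀_def
  set e₁ : ℝ := bogoliubovDispersionGP a (2 * Real.pi) with he₁_def
  have hc₀ : 0 < c₀ := Real.rpow_pos_of_pos hNpos _
  have hd : 0 ≤ max C 0 * c₀ := mul_nonneg (le_max_right _ _) hc₀.le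
  -- the two printed inequalities at `ℓ = 1`, side `N·1`
  obtain ⟨hup, hlow⟩ := hN N hN₀
  have hexp : (N : ℝ) ^ (-(1 : ℝ) / 4) = c₀ := by rw [hc₀_def]; norm_num
  have hε : Real.sqrt ((2 * Real.pi) ^ 4 + 16 * Real.pi * (a / 1) * (2 * Real.pi) ^ 2) = e₁ := by
    rw [div_one, he₁_def]; rfl
  have hr1 : (Real.sqrt ((2 * Real.pi) ^ 4 + 16 * Real.pi * (a / 1) * (2 * Real.pi) ^ 2) +
      C * (N : ℝ) ^ (-(1 : ℝ) / 4)) / ((N : ℝ) * 1) ^ 2 = (e₁ + C * c₀) / (N : ℝ) ^ 2 := by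
    rw [hε, hexp, mul_one]
  have hr2 : Real.sqrt ((2 * Real.pi) ^ 4 + 16 * Real.pi * (a / 1) * (2 * Real.pi) ^ 2) /
      ((N : ℝ) * 1) ^ 2 = e₁ / (N : ℝ) ^ 2 := by rw [hε, mul_one]
  have hr3 : C * (N : ℝ) ^ (-(1 : ℝ) / 4) / ((N : ℝ) * 1) ^ 2 = C * c₀ / (N : ℝ) ^ 2 := by
    rw [hexp, mul_one]
  rw [hr1] at hup
  rw [hr2, hr3] at hlow
  -- the rescaling `E = N² E₀`, `K = N² S₂`
  have hM : (N : ℝ) * 1 = N := mul_one _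
  rw [kyFanTwo_gpScaledPotential V hN1 hM, periodicGroundStateEnergy_gpScaledPotential V hN1 hM]
  set G : ℝ≥0∞ := periodicGroundStateEnergy V N ((N : ℝ) * 1) with hG_def
  set S : ℝ≥0∞ := kyFanTwo V N ((N : ℝ) * 1) with hS_def
  set X : ℝ≥0∞ := ENNReal.ofReal ((N : ℝ) ^ 2) with hX_def
  have hq1 : (N : ℝ) ^ 2 * ((e₁ + C * c₀) / (N : ℝ) ^ 2) = e₁ + C * c₀ := by
    field_simp
  have hq2 : (N : ℝ) ^ 2 * (e₁ / (N : ℝ) ^ 2) = e₁ := by field_simp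
  have hq3 : (N : ℝ) ^ 2 * (C * c₀ / (N : ℝ) ^ 2) = C * c₀ := by field_simp
  have hCc : C * c₀ ≤ max C 0 * c₀ := mul_le_mul_of_nonneg_right (le_max_left _ _) hc₀.le
  refine ⟨?_, ?_⟩
  · -- upper bound
    calc X * S ≤ X * (2 * G + ENNReal.ofReal ((e₁ + C * c₀) / (N : ℝ) ^ 2)) :=
          mul_le_mul_right hup _
      _ = 2 * (X * G) + ENNReal.ofReal (e₁ + C * c₀) := by
          rw [mul_add, mul_left_comm, hX_def, ← ENNReal.ofReal_mul hN2, hq1]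
      _ ≤ 2 * (X * G) + ENNReal.ofReal (e₁ + max C 0 * c₀) := by
          gcongr
  · -- lower bound
    have h3 : 2 * (X * G) + ENNReal.ofReal e₁ ≤ X * S + ENNReal.ofReal (max C 0 * c₀) := by
      have h1 := mul_le_mul_right hlow X
      rw [mul_add, mul_add, mul_left_comm, hX_def, ← ENNReal.ofReal_mul hN2,
        ← ENNReal.ofReal_mul hN2, hq2, hq3] at h1
      change 2 * (ENNReal.ofReal ((N : ℝ) ^ 2) * G) + ENNReal.ofReal e₁ ≤
        ENNReal.ofReal ((N : ℝ) ^ 2) * S + ENNReal.ofReal (C * c₀) at h1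
      exact h1.trans (by gcongr)
    rcases le_or_gt e₁ (max C 0 * c₀) with hle | hlt
    · rw [ENNReal.ofReal_of_nonpos (sub_nonpos.2 hle), add_zero, mul_left_comm]
      exact mul_le_mul_right (two_mul_periodicGroundStateEnergy_le_kyFanTwo V N _) _
    · have hsplit : ENNReal.ofReal (e₁ - max C 0 * c₀) + ENNReal.ofReal (max C 0 * c₀) =
          ENNReal.ofReal e₁ := by
        rw [← ENNReal.ofReal_add (sub_nonneg.2 hlt.le) hd, sub_add_cancel]
      refine (ENNReal.add_le_add_iff_right (a := ENNReal.ofReal (max C 0 * c₀))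
        ENNReal.ofReal_ne_top).1 ?_
      rw [add_assoc, hsplit]
      exact h3

/-! ### The scattering length under scaling (LSSY (5.3), BBCS p. 3) -/

/-- Change of variables on `ℝ³` for the lower Lebesgue integral, with no measurability
hypothesis: `∫ F(r x) dx = |r|⁻³ ∫ F` (`r ≠ 0`). [folklore] -/
theorem lintegral_space_comp_smul (F : Space → ℝ≥0∞) {r : ℝ} (hr : r ≠ 0) :
    ∫⁻ x, F (r • x) = ENNReal.ofReal |(r ^ 3)⁻¹| * ∫⁻ x, F x := by
  have h := lintegral_map_equiv F (Homeomorph.smulOfNeZero r hr).toMeasurableEquiv (μ := volume)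
  calc ∫⁻ x, F (r • x) = ∫⁻ a, F ((Homeomorph.smulOfNeZero r hr).toMeasurableEquiv a) := rfl
    _ = ∫⁻ a, F a ∂(Measure.map (fun x : Space => r • x) volume) := h.symm
    _ = ENNReal.ofReal |(r ^ 3)⁻¹| * ∫⁻ x, F x := by
        rw [Measure.map_addHaar_smul volume hr, lintegral_smul_measure, smul_eq_mul,
          finrank_euclideanSpace_fin]

/-- The dilate `φ(·/b)` of an admissible scattering trial function is admissible (`C¹`, and
`1 - φ(·/b)` is compactly supported). [cite: LSSY2005, App. C Thm. C.1] -/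
theorem isScatteringTrial_comp_inv_smul {φ : Space → ℝ} (hφ : IsScatteringTrial φ) {b : ℝ}
    (hb : b ≠ 0) : IsScatteringTrial fun x => φ (b⁻¹ • x) := by
  refine ⟨hφ.1.comp (contDiff_const_smul _), ?_⟩
  have : (fun x : Space => 1 - φ (b⁻¹ • x)) =
      (fun x => 1 - φ x) ∘ (Homeomorph.smulOfNeZero b⁻¹ (inv_ne_zero hb)) := rfl
  rw [this]
  exact hφ.2.comp_homeomorph _

/-- Chain rule for the dilated trial function: `D(φ(·/b))(x) w = Dφ(x/b)(w/b)`. [folklore] -/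
theorem fderiv_comp_inv_smul_apply {φ : Space → ℝ} (hφ : ContDiff ℝ 1 φ) (b : ℝ) (x w : Space) :
    fderiv ℝ (fun x => φ (b⁻¹ • x)) x w = fderiv ℝ φ (b⁻¹ • x) (b⁻¹ • w) := by
  have hd : DifferentiableAt ℝ φ (b⁻¹ • x) := (hφ.differentiable one_ne_zero) _
  have hs : HasFDerivAt (fun x : Space => b⁻¹ • x) (b⁻¹ • ContinuousLinearMap.id ℝ Space) x :=
    (ContinuousLinearMap.id ℝ Space).hasFDerivAt.const_smul b⁻¹
  have hcomp : HasFDerivAt (fun x : Space => φ (b⁻¹ • x))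
      ((fderiv ℝ φ (b⁻¹ • x)).comp (b⁻¹ • ContinuousLinearMap.id ℝ Space)) x :=
    hd.hasFDerivAt.comp x hs
  rw [hcomp.fderiv]
  simp

/-- `|∇φ(·/b)|²(x) = b⁻² |∇φ|²(x/b)`. [folklore] -/
theorem gradSq_comp_inv_smul {φ : Space → ℝ} (hφ : ContDiff ℝ 1 φ) {b : ℝ} (hb : 0 < b)
    (x : Space) :
    gradSq (fun x => φ (b⁻¹ • x)) x = (ENNReal.ofReal (b ^ 2))⁻¹ * gradSq φ (b⁻¹ • x) := by
  unfold gradSq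
  rw [Finset.mul_sum]
  refine Finset.sum_congr rfl fun k _ => ?_
  rw [fderiv_comp_inv_smul_apply hφ b, ContinuousLinearMap.map_smul, smul_eq_mul, nnnorm_mul,
    ENNReal.coe_mul, mul_pow]
  congr 1
  rw [← ENNReal.coe_pow, nnnorm_inv, Real.nnnorm_of_nonneg hb.le, inv_pow, ENNReal.ofReal_pow hb.le,
    ENNReal.ofReal, ← ENNReal.coe_pow, ENNReal.coe_inv (pow_ne_zero _ ?_)]
  · congr 2
    ext
    simp [hb.le]
  · rw [← NNReal.coe_ne_zero]
    simpa using hb.ne'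

/-- **Scaling of the scattering functional**: `𝓔_{b⁻²v(·/b)}[φ(·/b)] = b · 𝓔_v[φ]` (kinetic and
potential terms both pick up `b⁻²` from the scaling and `b³` from `dx`).
[cite: LSSY2005, App. C (C.4) with Ch. 5 (5.3)] -/
theorem scatteringFunctional_scaledPotential_comp (v : ℝ → ℝ≥0∞) {φ : Space → ℝ}
    (hφ : ContDiff ℝ 1 φ) {b : ℝ} (hb : 0 < b) :
    scatteringFunctional (scaledPotential v b) (fun x => φ (b⁻¹ • x)) =
      ENNReal.ofReal b * scatteringFunctional v φ := by
  unfold scatteringFunctional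
  have hpt : ∀ x : Space, gradSq (fun x => φ (b⁻¹ • x)) x +
      2⁻¹ * scaledPotential v b ‖x‖ * (‖φ (b⁻¹ • x)‖₊ : ℝ≥0∞) ^ 2 =
      (ENNReal.ofReal (b ^ 2))⁻¹ *
        (fun y => gradSq φ y + 2⁻¹ * v ‖y‖ * (‖φ y‖₊ : ℝ≥0∞) ^ 2) (b⁻¹ • x) := by
    intro x
    simp only [scaledPotential]
    rw [gradSq_comp_inv_smul hφ hb, norm_smul, norm_inv, Real.norm_of_nonneg hb.le,
      ← div_eq_inv_mul]
    ring
  simp_rw [hpt]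
  rw [lintegral_const_mul' _ _ (ENNReal.inv_ne_top.2 (by simpa using hb.ne')),
    lintegral_space_comp_smul (fun y => gradSq φ y + 2⁻¹ * v ‖y‖ * (‖φ y‖₊ : ℝ≥0∞) ^ 2)
      (inv_ne_zero hb.ne'), inv_pow, inv_inv, abs_of_pos (by positivity),
    ← mul_assoc]
  congr 1
  rw [← ENNReal.ofReal_inv_of_pos (by positivity), ← ENNReal.ofReal_mul (by positivity),
    show (b ^ 2)⁻¹ * b ^ 3 = b by field_simp]

/-- One half of the scaling law: `𝔞(b⁻²v(·/b)) ≤ b · 𝔞(v)` (dilate every trial function).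
[cite: LSSY2005, Ch. 5 (5.3)] -/
theorem scatteringLength_scaledPotential_le (v : ℝ → ℝ≥0∞) {b : ℝ} (hb : 0 < b) :
    scatteringLength (scaledPotential v b) ≤ ENNReal.ofReal b * scatteringLength v := by
  have h0 : ENNReal.ofReal b ≠ 0 := (ENNReal.ofReal_pos.2 hb).ne'
  unfold scatteringLength
  rw [mul_left_comm, ENNReal.mul_iInf_of_ne h0 ENNReal.ofReal_ne_top]
  refine mul_le_mul_right (le_iInf fun φ => ?_) _
  rw [ENNReal.mul_iInf_of_ne h0 ENNReal.ofReal_ne_top]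
  refine le_iInf fun hφ => ?_
  exact (iInf₂_le (fun x => φ (b⁻¹ • x)) (isScatteringTrial_comp_inv_smul hφ hb.ne')).trans_eq
    (scatteringFunctional_scaledPotential_comp v hφ.1 hb)

/-- **Scaling law of the scattering length**: `𝔞(b⁻²v(·/b)) = b · 𝔞(v)` — LSSY's remark at (5.3)
that `v = a⁻²v₁(·/a)` has scattering length `a` when `v₁` has scattering length `1`, and BBCS's
"the scattering length of `N²V(Nx)` is given by `𝔞₀/N`" (p. 3, after (1.3)); here for the
Lieb–Yngvason variational `scatteringLength` (dilate by `b` and back by `b⁻¹`).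
[cite: LSSY2005, Ch. 5 (5.3)] -/
theorem scatteringLength_scaledPotential (v : ℝ → ℝ≥0∞) {b : ℝ} (hb : 0 < b) :
    scatteringLength (scaledPotential v b) = ENNReal.ofReal b * scatteringLength v := by
  refine le_antisymm (scatteringLength_scaledPotential_le v hb) ?_
  have h := scatteringLength_scaledPotential_le (scaledPotential v b) (inv_pos.2 hb)
  rw [scaledPotential_scaledPotential_inv hb] at h
  calc ENNReal.ofReal b * scatteringLength v
      ≤ ENNReal.ofReal b * (ENNReal.ofReal b⁻¹ * scatteringLength (scaledPotential v b)) :=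
        mul_le_mul_right h _
    _ = scatteringLength (scaledPotential v b) := by
        rw [← mul_assoc, ← ENNReal.ofReal_mul hb.le, mul_inv_cancel₀ hb.ne', ENNReal.ofReal_one,
          one_mul]


/-! ### The box-variable fact from the unit-torus fact -/

/-- The scaled profile `b⁻²v(·/b)` of a measurable profile is measurable. [folklore] -/
theorem measurable_scaledPotential {v : ℝ → ℝ≥0∞} (hv : Measurable v) (b : ℝ) :
    Measurable (scaledPotential v b) :=
  measurable_const.mul (hv.comp (measurable_id.div_const b))

/-- **BBCS Theorem 1.1 (first excited level): the box-variable rendering follows from the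
unit-torus rendering.** Given `v`, `R₀`, `ℓ > 0`, apply `BoccatoEtAl2019Acta_firstExcitation` to
the profile `V = ℓ²v(ℓ·) = scaledPotential v ℓ⁻¹` (measurable, of range `R₀/ℓ`, in `L³`, with
scattering length `a/ℓ` by `scatteringLength_scaledPotential`, so that its `e(2π)` is the `ε` of
the box statement); then `E(N²V(N·), N, 1) = N²E(V, N, N) = (Nℓ)²E(v, N, Nℓ)` and likewise for the
Ky-Fan two-sum (`v = ℓ⁻²V(·/ℓ)`), and dividing the two unit-torus inequalities by `L² = (Nℓ)²`
gives the printed box form (the lower one after moving the error term to the right with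
`ofReal ε ≤ ofReal (ε - CN^{-1/4}) + ofReal (CN^{-1/4})`).
[cite: BoccatoEtAl2019Acta, Thm 1.1 with §6 (6.2) (m = 2) and p. 4 (trivial rescaling)] -/
theorem BoccatoEtAl2019_firstGap_GP_of_firstExcitation (h : BoccatoEtAl2019Acta_firstExcitation) :
    BoccatoEtAl2019_firstGap_GP := by
  intro v R₀ ℓ hv hR₀ hL3 hℓ
  -- the profile of unit GP length: `V = ℓ² v(ℓ ·)`, so that `v = ℓ⁻² V(·/ℓ)`
  set V : ℝ → ℝ≥0∞ := scaledPotential v ℓ⁻¹ with hV_def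
  have hvV : scaledPotential V ℓ = v := by
    simpa only [inv_inv] using scaledPotential_scaledPotential_inv (inv_pos.2 hℓ) v
  have hVm : Measurable V := measurable_scaledPotential hv _
  have hVsupp : ∃ R₁ : ℝ, ∀ r, R₁ ≤ r → V r = 0 := by
    refine ⟨R₀ / ℓ + 1, fun r hr => ?_⟩
    have hlt : R₀ < r / ℓ⁻¹ := by
      rw [div_inv_eq_mul, ← div_lt_iff₀ hℓ]
      linarith
    simp only [hV_def, scaledPotential, hR₀ _ hlt, mul_zero]
  have hVL3 : (∫⁻ x : Space, V ‖x‖ ^ 3) ≠ ⊤ := by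
    have hc : (ENNReal.ofReal (ℓ⁻¹ ^ 2))⁻¹ ≠ ⊤ :=
      ENNReal.inv_ne_top.2 (ENNReal.ofReal_pos.2 (by positivity)).ne'
    have hpt : ∀ x : Space, V ‖x‖ ^ 3 =
        (ENNReal.ofReal (ℓ⁻¹ ^ 2))⁻¹ ^ 3 * (fun y : Space => v ‖y‖ ^ 3) (ℓ • x) := by
      intro x
      simp only [hV_def, scaledPotential]
      rw [mul_pow, norm_smul, Real.norm_of_nonneg hℓ.le, div_inv_eq_mul, mul_comm ‖x‖ ℓ]
    simp_rw [hpt]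
    rw [lintegral_const_mul' _ _ (ENNReal.pow_ne_top hc),
      lintegral_space_comp_smul (fun y : Space => v ‖y‖ ^ 3) hℓ.ne']
    exact ENNReal.mul_ne_top (ENNReal.pow_ne_top hc) (ENNReal.mul_ne_top ENNReal.ofReal_ne_top hL3)
  -- scattering length `a/ℓ`
  have ha : (scatteringLength V).toReal = (scatteringLength v).toReal / ℓ := by
    rw [hV_def, scatteringLength_scaledPotential v (inv_pos.2 hℓ), ENNReal.toReal_mul,
      ENNReal.toReal_ofReal (inv_pos.2 hℓ).le, div_eq_inv_mul]
  obtain ⟨C, N₀, hN⟩ := h V hVm hVL3 hVsupp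
  refine ⟨C, max N₀ 1, fun N hNle => ?_⟩
  have hN₀ : N₀ ≤ N := le_of_max_le_left hNle
  have hN1 : 1 ≤ N := le_of_max_le_right hNle
  have hNpos : (0 : ℝ) < N := by exact_mod_cast hN1
  dsimp only
  set a : ℝ := (scatteringLength v).toReal with ha_def
  set c₀ : ℝ := (N : ℝ) ^ (-(1 / 4 : ℝ)) with hc₀_def
  set ε : ℝ := Real.sqrt ((2 * Real.pi) ^ 4 + 16 * Real.pi * (a / ℓ) * (2 * Real.pi) ^ 2)
    with hε_def
  have hexp : (N : ℝ) ^ (-(1 : ℝ) / 4) = c₀ := by rw [hc₀_def]; norm_num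
  rw [hexp]
  obtain ⟨hup, hlow⟩ := hN N hN₀
  have he₁ : bogoliubovDispersionGP (scatteringLength V).toReal (2 * Real.pi) = ε := by
    rw [ha, hε_def, bogoliubovDispersionGP]
  -- the rescalings: unit torus → box of side `N` (× N²) → box of side `Nℓ` with `v` (× ℓ²)
  set E₀ : ℝ≥0∞ := periodicGroundStateEnergy v N ((N : ℝ) * ℓ) with hE₀_def
  set S : ℝ≥0∞ := kyFanTwo v N ((N : ℝ) * ℓ) with hS_def
  set Y : ℝ≥0∞ := ENNReal.ofReal (((N : ℝ) * ℓ) ^ 2) with hY_def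
  have hΛ0 : ENNReal.ofReal (ℓ ^ 2) ≠ 0 := (ENNReal.ofReal_pos.2 (by positivity)).ne'
  have hNℓ : (N : ℝ) * ℓ = ℓ * N := mul_comm _ _
  have hL2 : (N : ℝ) ^ 2 * ℓ ^ 2 = ((N : ℝ) * ℓ) ^ 2 := by ring
  have hE2 : periodicGroundStateEnergy V N N = ENNReal.ofReal (ℓ ^ 2) * E₀ := by
    have h2 := periodicGroundStateEnergy_scaledPotential_of_eq hℓ hNℓ V N
    rw [hvV] at h2
    rw [hE₀_def, h2, ← mul_assoc, ENNReal.mul_inv_cancel hΛ0 ENNReal.ofReal_ne_top, one_mul]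
  have hK2 : kyFanTwo V N N = ENNReal.ofReal (ℓ ^ 2) * S := by
    have h2 := kyFanTwo_scaledPotential hℓ hNℓ V N
    rw [hvV] at h2
    rw [hS_def, h2, ← mul_assoc, ENNReal.mul_inv_cancel hΛ0 ENNReal.ofReal_ne_top, one_mul]
  have hEY : periodicGroundStateEnergy (gpScaledPotential V N) N 1 = Y * E₀ := by
    rw [periodicGroundStateEnergy_gpScaledPotential V hN1 rfl, hE2, ← mul_assoc,
      ← ENNReal.ofReal_mul (sq_nonneg _), hL2]
  have hKY : kyFanTwo (gpScaledPotential V N) N 1 = Y * S := by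
    rw [kyFanTwo_gpScaledPotential V hN1 rfl, hK2, ← mul_assoc,
      ← ENNReal.ofReal_mul (sq_nonneg _), hL2]
  rw [hEY, hKY, he₁, ← hc₀_def] at hup hlow
  have hY0 : Y ≠ 0 := (ENNReal.ofReal_pos.2 (by positivity)).ne'
  have hYt : Y ≠ ⊤ := ENNReal.ofReal_ne_top
  have hL0 : ((N : ℝ) * ℓ) ^ 2 ≠ 0 := by positivity
  have hYq : ∀ q : ℝ, Y * ENNReal.ofReal (q / ((N : ℝ) * ℓ) ^ 2) = ENNReal.ofReal q := by
    intro q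
    rw [hY_def, ← ENNReal.ofReal_mul (sq_nonneg _), mul_div_cancel₀ _ hL0]
  refine ⟨?_, ?_⟩
  · -- upper bound: divide `hup` by `L²`
    refine (ENNReal.mul_le_mul_iff_right hY0 hYt).1 ?_
    calc Y * S ≤ 2 * (Y * E₀) + ENNReal.ofReal (ε + C * c₀) := hup
      _ = Y * (2 * E₀ + ENNReal.ofReal ((ε + C * c₀) / ((N : ℝ) * ℓ) ^ 2)) := by
          rw [mul_add, mul_left_comm, hYq]
  · -- lower bound: move the error to the right, then divide by `L²`
    refine (ENNReal.mul_le_mul_iff_right hY0 hYt).1 ?_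
    calc Y * (2 * E₀ + ENNReal.ofReal (ε / ((N : ℝ) * ℓ) ^ 2))
        = 2 * (Y * E₀) + ENNReal.ofReal ε := by rw [mul_add, mul_left_comm, hYq]
      _ ≤ 2 * (Y * E₀) + (ENNReal.ofReal (ε - C * c₀) + ENNReal.ofReal (C * c₀)) := by
          have hε' : ENNReal.ofReal ε ≤ ENNReal.ofReal (ε - C * c₀) + ENNReal.ofReal (C * c₀) :=
            calc ENNReal.ofReal ε = ENNReal.ofReal ((ε - C * c₀) + C * c₀) := by
                  rw [sub_add_cancel]
              _ ≤ _ := ENNReal.ofReal_add_le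
          exact add_le_add_right hε' _
      _ = (2 * (Y * E₀) + ENNReal.ofReal (ε - C * c₀)) + ENNReal.ofReal (C * c₀) := by
          rw [add_assoc]
      _ ≤ Y * S + ENNReal.ofReal (C * c₀) := add_le_add_left hlow _
      _ = Y * (S + ENNReal.ofReal (C * c₀ / ((N : ℝ) * ℓ) ^ 2)) := by
          rw [mul_add, hYq]


/-- **The two renderings of BBCS Theorem 1.1 (first excited level) in the tree are equivalent**:
the unit-torus form `BoccatoEtAl2019Acta_firstExcitation` (`BogoliubovSpectrumGP.lean`) and the
box-variable form `BoccatoEtAl2019_firstGap_GP` (`BogoliubovSpectralGapGP.lean`) imply each other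
by the "trivial rescaling" of p. 4; discharging either named fact discharges both.
[cite: BoccatoEtAl2019Acta, Thm 1.1 and p. 4 (trivial rescaling)] -/
theorem BoccatoEtAl2019Acta_firstExcitation_iff_firstGap_GP :
    BoccatoEtAl2019Acta_firstExcitation ↔ BoccatoEtAl2019_firstGap_GP :=
  ⟨BoccatoEtAl2019_firstGap_GP_of_firstExcitation, BoccatoEtAl2019Acta_firstExcitation_of_firstGap_GP⟩

end Literature.MathematicalPhysics.QuantumManyBody.BoseGas

end
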